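import Mathlib
import Summits.NavierStokesRegularity.NavierStokesRegularity.Theorems.TypeIQuarterGateScarEnvelopeTypeISatelliteTowerRecurrentTransport
import Summits.NavierStokesRegularity.NavierStokesRegularity.Theorems.TypeIQuarterGateScarEnvelopeTypeISatelliteTowerGalleryRootOmega
import Summits.NavierStokesRegularity.NavierStokesRegularity.Theorems.TypeIQuarterGateScarEnvelopeTypeISatelliteTowerGalleryMinRate
import Summits.NavierStokesRegularity.NavierStokesRegularity.Theorems.TypeIQuarterGateScarEnvelopeTypeISatelliteTowerGalleryTransitive
import Summits.NavierStokesRegularity.NavierStokesRegularity.Theorems.TypeIQuarterGateScarEnvelopeTypeISatelliteTowerEnvelopeLeaves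
import Summits.NavierStokesRegularity.NavierStokesRegularity.Theorems.TypeIQuarterGateScarEnvelopeTypeISatelliteTowerRigidRoot
import Summits.NavierStokesRegularity.NavierStokesRegularity.Theorems.TypeIQuarterGateScarEnvelopeTypeIScarSetTopology
import Summits.NavierStokesRegularity.NavierStokesRegularity.Theorems.RecurrentProfilesRecurrentLiouvillePrBlowupDichotomy
import Summits.NavierStokesRegularity.NavierStokesRegularity.Theorems.RecurrentProfilesRecurrentLiouvillePrScalingStabilizer
import Summits.NavierStokesRegularity.NavierStokesRegularity.Theorems.SqueezeCycleRecurrentLiouvilleNearIdentityDSS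
import Summits.NavierStokesRegularity.NavierStokesRegularity.Theorems.RecurrentProfilesRecurrentReductionOrbit
import Literature.Analysis.FluidPDE.TypeIRateClassicalRepresentative
import Literature.Analysis.FluidPDE.TypeIAncientMildRescale
import Literature.Analysis.FluidPDE.ScalingUniformRecurrence
import Literature.Analysis.FluidPDE.TypeIAncientMildClassical
import Literature.Analysis.FluidPDE.PineauVicolRSSChaeWolf
import Literature.Analysis.FluidPDE.NSLerayStrongLocalExistence
import Literature.Barriers.NavierStokesRegularity.NearOneDssTypeIExclusion

/-!
# Satellite tower for crux `ScarEnvelopeTypeI` (stmt-NavierStokesRegularity-23843) — Part Z0–Z1: THE HULL JUNCTION — the census object IS a Type-I singularity model of crux 1589 `RecurrentLiouville`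

Part Z0–Z1 of nsreg-p3 g28's ROUND-44 artefact (section `HullJunction`): Z0 small tools (a.e. on cylinders ↔ a.e. on the slab, pointwise on the open past);
Z1 `ABTower.prClass` — the class bridge: a rooted A–B object of the census IS a «Type-I singularity model» of route RecurrentProfiles' crux 1589
(suitable weak on the backward slab, weak gradient, `𝐈 < ⊤`, rate, backward-singular origin). IN-TREE DISCLOSURE: the dynamics used in Part Z is the
tree's (T6 `stub_prBlowupDichotomy`, H4 `stub_prScalingStabilizer`, `stub_prStabilizerOfLimit`, hull dichotomy), imported BY NAME, not re-derived.

PROVENANCE: declaration texts VERBATIM from the HOME artefact of the instrument seat nsreg-p3 g27 (cell `pub/ns-regularity-ideate`):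
`round-44/Junction44.lean` (sha16 `ec5c26d3f01f4277`, parts `partZ1…partZ7.lean`; a module written against the TREE, importing route
RecurrentProfiles' crux-1589 dynamics modules BY NAME; memo `round-44/ROUND-44.md` c316de8a95807228), scored PASS ★★ by referee ref3 g27
(`SCORE-p3-ROUND-44-0828.md` f10387a6f12e4133); the author cannot write under `Theorems/`
(`perm.theorems-prover-only`); landed by the prover ns-es-p1 g5 as landing hand of record (director-ns DIRECTOR-NS #237 (3)), split into
≤ 400-line modules, `E3` spelled out, the artefact's `#guard_msgs … #print axioms` certificates not landed.
`--supports stmt-NavierStokesRegularity-23843 --as helper`.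

HONEST FRAMING: instrument theorems about HYPOTHETICAL Type-I zoom limits (Albritton–Barker objects of the census of crux
`TypeIQuarterGate.ScarEnvelopeTypeI`, item 23843); the analytic input is the tree's closure engine (compactness
`local_typeI_compactness_twin_inBall`, sharpened to constant 1 in Part S1; Q1 whole-space), P1 rate inheritance, L8 persistence and the
tree's PROVED small-constant Liouville theorem; Parts R/S are order theory on the re-classing and closure lemmas.  NOTHING OPEN IS
PROVED: 23843, (L′) `TypeILiouvilleAB` / (L′₀), the GLOBAL (S∞) = `CritAttained`, (M𝐈₁), (E1⁺), (E2ᵣ), route ExtremalTypeIConstant's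
cruxes, N0 and Navier–Stokes regularity are OPEN; `critRate`, `levelCrit I`, `liouvilleRate` are `sInf`s that are `0` by junk value
when the defining set is empty (every statement using them carries the nonemptiness hypothesis explicitly).
-/

-- the summit-side namespace repeats a component by design (single-conjunct summit, D-0017)
set_option linter.dupNamespace false

open MeasureTheory Set Metric Filter Topology
open scoped ENNReal NNReal InnerProductSpace
open Literature.Analysis.FluidPDE

namespace Summit.NavierStokesRegularity.NavierStokesRegularity.Cruxes.ScarEnvelopeTypeI.ZoomDictionary

section HullJunction

variable {U U₁ U₂ W : ℝ → (EuclideanSpace ℝ (Fin 3)) → (EuclideanSpace ℝ (Fin 3))}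
  {P : ℝ → (EuclideanSpace ℝ (Fin 3)) → ℝ}
  {H : ℝ → (EuclideanSpace ℝ (Fin 3)) → (EuclideanSpace ℝ (Fin 3)) →L[ℝ] (EuclideanSpace ℝ (Fin 3))}
  {M : ℝ}

/-! ### Z0. Small tools: a.e. on cylinders ↔ a.e. on the slab, pointwise on the open past -/

/-- A property holding a.e. on every `Q_R(0)`, `R > 0`, holds a.e. on the open backward slab. -/
theorem ae_slab_of_forall_cylinder {p : ℝ × (EuclideanSpace ℝ (Fin 3)) → Prop}
    (h : ∀ R : ℝ, 0 < R →
      ∀ᵐ z ∂(volume.restrict (parabolicCylinder R (0 : ℝ × (EuclideanSpace ℝ (Fin 3))))), p z) :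
    ∀ᵐ z ∂(volume.restrict (Iio (0 : ℝ) ×ˢ (univ : Set (EuclideanSpace ℝ (Fin 3))))), p z := by
  refine ae_restrict_of_ae_restrict_of_subset
    Summit.NavierStokesRegularity.NavierStokesRegularity.Theorems.lowerHalf_subset_iUnion_parabolicCylinder ?_
  rw [ae_restrict_iUnion_iff]
  intro n
  exact h _ (by positivity)

/-- Conversely, a property holding a.e. on the slab holds a.e. on every `Q_R(0)`. -/
theorem ae_cylinder_of_ae_slab {p : ℝ × (EuclideanSpace ℝ (Fin 3)) → Prop}
    (h : ∀ᵐ z ∂(volume.restrict (Iio (0 : ℝ) ×ˢ (univ : Set (EuclideanSpace ℝ (Fin 3))))), p z)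
    (R : ℝ) :
    ∀ᵐ z ∂(volume.restrict (parabolicCylinder R (0 : ℝ × (EuclideanSpace ℝ (Fin 3))))), p z :=
  ae_restrict_of_ae_restrict_of_subset (parabolicCylinder_origin_subset_slab R) h

/-- Two fields continuous on the open past and a.e. equal on the slab agree at EVERY `t < 0`. -/
theorem eq_past_of_ae_slab (h₁ : ContinuousOn (Function.uncurry U₁) (Iio 0 ×ˢ univ))
    (h₂ : ContinuousOn (Function.uncurry U₂) (Iio 0 ×ˢ univ))
    (hae : ∀ᵐ z ∂(volume.restrict (Iio (0 : ℝ) ×ˢ (univ : Set (EuclideanSpace ℝ (Fin 3))))),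
      U₁ z.1 z.2 = U₂ z.1 z.2) :
    ∀ t < 0, ∀ x, U₁ t x = U₂ t x := by
  have h := Measure.eqOn_open_of_ae_eq (hae.mono fun z hz => hz) (isOpen_Iio.prod isOpen_univ) h₁ h₂
  intro t ht x
  exact h (mk_mem_prod ht (mem_univ x))

/-- A field with a weak spatial gradient on the slab is a.e.-strongly measurable on every `Q_R(0)`. -/
theorem aestronglyMeasurable_cylinder_of_hasWeakSpatialGradientOn
    {G : ℝ → (EuclideanSpace ℝ (Fin 3)) → (EuclideanSpace ℝ (Fin 3)) →L[ℝ] (EuclideanSpace ℝ (Fin 3))}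
    (h : HasWeakSpatialGradientOn (slab (EuclideanSpace ℝ (Fin 3)) (Iio 0) isOpen_Iio) W G) (R : ℝ) :
    AEStronglyMeasurable (Function.uncurry W)
      (volume.restrict (parabolicCylinder R (0 : ℝ × (EuclideanSpace ℝ (Fin 3))))) := by
  have h1 : AEStronglyMeasurable (Function.uncurry W)
      (volume.restrict (Iio (0 : ℝ) ×ˢ (univ : Set (EuclideanSpace ℝ (Fin 3))))) :=
    h.locallyIntegrableOn.aestronglyMeasurable
  exact h1.mono_measure (Measure.restrict_mono (parabolicCylinder_origin_subset_slab R) le_rfl)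

/-- An `L³(Q_R(0))`-limit (every `R`) of zooms of an `L³_loc` field, a.e.-strongly measurable on the
cylinders, is itself `L³_loc`. -/
theorem l3loc_of_zoomsTendsto (hU : L3loc U) {x : ℕ → (EuclideanSpace ℝ (Fin 3))} {l : ℕ → ℝ}
    (hl : ∀ j, 0 < l j)
    (hWm : ∀ R : ℝ, 0 < R → AEStronglyMeasurable (Function.uncurry W)
      (volume.restrict (parabolicCylinder R (0 : ℝ × (EuclideanSpace ℝ (Fin 3))))))
    (hconv : ZoomsTendsto U x l W) : L3loc W := by
  intro R hR
  refine ⟨hWm R hR, ?_⟩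
  obtain ⟨j, hj⟩ := ((hconv R hR).eventually (gt_mem_nhds zero_lt_one)).exists
  have hz : MemLp (Function.uncurry (zoom U (x j) 0 (l j))) 3
      (volume.restrict (parabolicCylinder R (0 : ℝ × (EuclideanSpace ℝ (Fin 3))))) :=
    (hU.galleryMap (x j) (hl j)) R hR
  have e : Function.uncurry W =
      Function.uncurry (zoom U (x j) 0 (l j)) -
        (Function.uncurry (zoom U (x j) 0 (l j)) - Function.uncurry W) := by
    abel
  rw [e]
  refine lt_of_le_of_lt (eLpNorm_sub_le hz.1 (hz.1.sub (hWm R hR)) (by norm_num)) ?_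
  exact ENNReal.add_lt_top.2 ⟨hz.2, hj.trans ENNReal.one_lt_top⟩

/-- Zoom convergence is insensitive to changing the limit on a null set of every cylinder. -/
theorem ZoomsTendsto.congr_limit_ae {x : ℕ → (EuclideanSpace ℝ (Fin 3))} {l : ℕ → ℝ}
    (h : ZoomsTendsto U x l W) {W' : ℝ → (EuclideanSpace ℝ (Fin 3)) → (EuclideanSpace ℝ (Fin 3))}
    (hae : ∀ R : ℝ, 0 < R →
      ∀ᵐ z ∂(volume.restrict (parabolicCylinder R (0 : ℝ × (EuclideanSpace ℝ (Fin 3))))),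
        W z.1 z.2 = W' z.1 z.2) :
    ZoomsTendsto U x l W' := by
  intro R hR
  have e : ∀ j, eLpNorm (Function.uncurry (zoom U (x j) 0 (l j)) - Function.uncurry W') 3
        (volume.restrict (parabolicCylinder R (0 : ℝ × (EuclideanSpace ℝ (Fin 3))))) =
      eLpNorm (Function.uncurry (zoom U (x j) 0 (l j)) - Function.uncurry W) 3
        (volume.restrict (parabolicCylinder R (0 : ℝ × (EuclideanSpace ℝ (Fin 3))))) := by
    intro j
    refine eLpNorm_congr_ae ?_
    filter_upwards [hae R hR] with z hz
    simp only [Pi.sub_apply]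
    change _ - W' z.1 z.2 = _ - W z.1 z.2
    rw [hz]
  simpa only [e] using h R hR

/-- The root zooms of `U` at scales `l j` converge to `W` in every `L³(Q_R(0))` iff the KNSS rescalings
`nsRescale (l j) U` do (the root zoom IS the rescaling, `zoom_zero_eq_nsRescale`). -/
theorem zoomsTendsto_zero_iff_nsRescale {l : ℕ → ℝ} :
    ZoomsTendsto U (fun _ => 0) l W ↔
      ∀ R : ℝ, 0 < R → Tendsto (fun j => eLpNorm
        (Function.uncurry (nsRescale (l j) U) - Function.uncurry W) 3
        (volume.restrict (parabolicCylinder R (0 : ℝ × (EuclideanSpace ℝ (Fin 3)))))) atTop (𝓝 0) := by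
  simp only [ZoomsTendsto, zoom_zero_eq_nsRescale]

/-- `¬ RegPt U y` is the backward singularity of `(0, y)` in the sense of Albritton–Barker. -/
theorem isBackwardSingularPoint_of_not_regPt {y : (EuclideanSpace ℝ (Fin 3))} (h : ¬ RegPt U y) :
    IsBackwardSingularPoint U ((0 : ℝ), y) := by
  intro r hr
  by_contra hne
  apply h
  refine ⟨r, hr, (eLpNorm (Function.uncurry U) ⊤
    (volume.restrict (parabolicCylinder r (((0 : ℝ), y) : ℝ × (EuclideanSpace ℝ (Fin 3)))))).toReal, ?_⟩
  filter_upwards [ae_le_eLpNormEssSup (f := Function.uncurry U)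
    (μ := volume.restrict (parabolicCylinder r (((0 : ℝ), y) : ℝ × (EuclideanSpace ℝ (Fin 3)))))]
    with z hz
  rw [← eLpNorm_exponent_top] at hz
  have h1 := ENNReal.toReal_mono hne hz
  rwa [toReal_enorm] at h1

/-- The two singularity notions agree at final-time points. -/
theorem not_regPt_iff_isBackwardSingularPoint {y : (EuclideanSpace ℝ (Fin 3))} :
    ¬ RegPt U y ↔ IsBackwardSingularPoint U ((0 : ℝ), y) :=
  ⟨isBackwardSingularPoint_of_not_regPt, not_regPt_of_isBackwardSingularPoint⟩

/-! ### Z1. THE CLASS BRIDGE: rooted A–B objects are the Type-I singularity models of crux 1589 -/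

/-- ★ **Z1. The census object IS route RecurrentProfiles' «Type-I singularity model».**  An A–B object of
the class `M` is a suitable weak solution on the whole backward slab (the balls `Q(0,a)` exhaust it,
`isSuitableWeakSolutionOn_slab_of_forall_inBall`), with its weak gradient on the slab, `𝐈 < ⊤` and the
rate `M` — the four standing hypotheses of `stub_prScalingStabilizer` / `stub_prHullDichotomy` /
`stub_prBlowupDichotomy` (crux `RecurrentLiouville`, stmt-1589); `¬ RegPt U 0` is their fifth
(`not_regPt_iff_isBackwardSingularPoint`). -/
theorem ABTower.prClass (hT : ABTower M U P H) :
    IsSuitableWeakSolutionOn (slab (EuclideanSpace ℝ (Fin 3)) (Iio 0) isOpen_Iio) 1 0 U P ∧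
      HasWeakSpatialGradientOn (slab (EuclideanSpace ℝ (Fin 3)) (Iio 0) isOpen_Iio) U H ∧
      typeIBound (Iio (0 : ℝ) ×ˢ univ) U P H < ⊤ ∧ HasTypeITimeDecay M U :=
  ⟨isSuitableWeakSolutionOn_slab_of_forall_inBall hT.2.1, hT.2.2.1, hT.2.2.2, hT.1.hasTypeITimeDecay⟩

/-- The origin of `ℝ × ℝ³` as a pair. -/
theorem prod_zero_eq : (0 : ℝ × (EuclideanSpace ℝ (Fin 3))) = ((0 : ℝ), (0 : (EuclideanSpace ℝ (Fin 3)))) := rfl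

/-- A rooted object is backward-singular at the space–time origin. -/
theorem RootObj.isBackwardSingularPoint {n : TNode} (hn : RootObj M n) :
    IsBackwardSingularPoint n.U (0 : ℝ × (EuclideanSpace ℝ (Fin 3))) := by
  rw [prod_zero_eq]
  exact isBackwardSingularPoint_of_not_regPt hn.2

/-! ### Z2. Past-DSS transfers across a.e.-agreement; root ω-limit re-entry -/

/-- A.e. self-similarity on the slab of a field agreeing a.e. on the slab with an A–B object makes the A–B
object EXACTLY `μ`-DSS ON THE OPEN PAST (continuity of the object and of its rescaling). -/
theorem ABTower.pastDss_of_ae (hT : ABTower M U P H) {μ : ℝ} (hμ : 0 < μ)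
    (hae : ∀ᵐ z ∂(volume.restrict (Iio (0 : ℝ) ×ˢ (univ : Set (EuclideanSpace ℝ (Fin 3))))),
      U z.1 z.2 = W z.1 z.2)
    (hdss : ∀ᵐ z ∂(volume.restrict (Iio (0 : ℝ) ×ˢ (univ : Set (EuclideanSpace ℝ (Fin 3))))),
      nsRescale μ W z.1 z.2 = W z.1 z.2) :
    ∀ t < 0, ∀ x, nsRescale μ U t x = U t x := by
  have h1 := Summit.NavierStokesRegularity.NavierStokesRegularity.Theorems.rlNearIdentityDSS_ae_comp_dilation
    (F := fun z => U z.1 z.2) (G := fun z => W z.1 z.2) hμ hae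
  have hae' : ∀ᵐ z ∂(volume.restrict (Iio (0 : ℝ) ×ˢ (univ : Set (EuclideanSpace ℝ (Fin 3))))),
      nsRescale μ U z.1 z.2 = U z.1 z.2 := by
    filter_upwards [h1, hae, hdss] with z hz hz' hz''
    simp only [nsRescale_apply] at hz'' ⊢
    rw [hz, hz'', ← hz']
  exact eq_past_of_ae_slab (hT.1.nsRescale hμ).continuousOn_uncurry hT.1.continuousOn_uncurry hae'

/-- **Root ω-limit RE-ENTRY.**  If the KNSS rescalings `nsRescale (l j) n.U`, `l j → 0⁺`, of a rooted A–B object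
converge in every `L³(Q_R(0))` to a field `w` carrying a weak gradient on the slab, then `w` is a root
ω-limit of `n.U` and has a ROOTED A–B representative of the same class, `𝐈 ≤ 4·𝐈(n)`, agreeing with `w`
a.e. on the slab, itself a root ω-limit of `n.U` along the same scales. -/
theorem RootObj.reentry {n : TNode} (hn : RootObj M n)
    {w : ℝ → (EuclideanSpace ℝ (Fin 3)) → (EuclideanSpace ℝ (Fin 3))}
    {G : ℝ → (EuclideanSpace ℝ (Fin 3)) → (EuclideanSpace ℝ (Fin 3)) →L[ℝ] (EuclideanSpace ℝ (Fin 3))}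
    (hwg : HasWeakSpatialGradientOn (slab (EuclideanSpace ℝ (Fin 3)) (Iio 0) isOpen_Iio) w G)
    {l : ℕ → ℝ} (hl : ∀ j, 0 < l j) (hl0 : Tendsto l atTop (𝓝 0))
    (hconv : ∀ R : ℝ, 0 < R → Tendsto (fun j => eLpNorm
      (Function.uncurry (nsRescale (l j) n.U) - Function.uncurry w) 3
      (volume.restrict (parabolicCylinder R (0 : ℝ × (EuclideanSpace ℝ (Fin 3)))))) atTop (𝓝 0)) :
    IsRootOmegaLimit n.U w ∧
    ∃ (U' : ℝ → (EuclideanSpace ℝ (Fin 3)) → (EuclideanSpace ℝ (Fin 3))) (P' : ℝ → (EuclideanSpace ℝ (Fin 3)) → ℝ)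
      (H' : ℝ → (EuclideanSpace ℝ (Fin 3)) → (EuclideanSpace ℝ (Fin 3)) →L[ℝ] (EuclideanSpace ℝ (Fin 3))),
      ABTower M U' P' H' ∧ ¬ RegPt U' 0 ∧
      typeIBound (Iio (0 : ℝ) ×ˢ univ) U' P' H' ≤ 4 * typeIBound (Iio (0 : ℝ) ×ˢ univ) n.U n.P n.H ∧
      (∀ᵐ z ∂(volume.restrict (Iio (0 : ℝ) ×ˢ (univ : Set (EuclideanSpace ℝ (Fin 3))))), U' z.1 z.2 = w z.1 z.2) ∧
      (∀ R : ℝ, 0 < R →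
        ∀ᵐ z ∂(volume.restrict (parabolicCylinder R (0 : ℝ × (EuclideanSpace ℝ (Fin 3))))), U' z.1 z.2 = w z.1 z.2) ∧
      ZoomsTendsto n.U (fun _ => 0) l U' ∧ IsRootOmegaLimit n.U U' := by
  have hconv' : ZoomsTendsto n.U (fun _ => 0) l w := zoomsTendsto_zero_iff_nsRescale.2 hconv
  have hwm := aestronglyMeasurable_cylinder_of_hasWeakSpatialGradientOn hwg
  have hw3 : L3loc w := l3loc_of_zoomsTendsto hn.1.l3loc hl (fun R _ => hwm R) hconv'
  have hω : IsRootOmegaLimit n.U w := ⟨hw3, l, hl, hl0, hconv'⟩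
  obtain ⟨U', P', H', hT', h4, hae, h0'⟩ := abTower_of_isRootOmegaLimit hn.1 hn.2 hω
  have hae' : ∀ R : ℝ, 0 < R →
      ∀ᵐ z ∂(volume.restrict (parabolicCylinder R (0 : ℝ × (EuclideanSpace ℝ (Fin 3))))), U' z.1 z.2 = w z.1 z.2 :=
    fun R hR => (hae R hR).mono fun z hz => hz.symm
  have hconvU : ZoomsTendsto n.U (fun _ => 0) l U' := hconv'.congr_limit_ae hae
  exact ⟨hω, U', P', H', hT', h0', h4, ae_slab_of_forall_cylinder hae', hae', hconvU,
    ⟨hT'.l3loc, l, hl, hl0, hconvU⟩⟩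

end HullJunction

end Summit.NavierStokesRegularity.NavierStokesRegularity.Cruxes.ScarEnvelopeTypeI.ZoomDictionary
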